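import Mathlib
import HarnessLib
import Summits.HubbardSuperconductivity.HubbardSuperconductivity.Theorems.KLProgrammeKLRegimeVolumeLimitFlowFramesV17F2
import Summits.HubbardSuperconductivity.HubbardSuperconductivity.Theorems.KLProgrammeKLRegimeVolumeLimitGibbsDoor
import Summits.HubbardSuperconductivity.HubbardSuperconductivity.Theses.KLProgramme

/-!
# Gen-8 (rev-22) flow VL child `KLRegimeVolumeLimitV17F2` (stmt-HubbardSuperconductivity-20440, CURED bundle `klPredsV17F2`, K3-FLOW RULING F + (R32′)): the
# ROUTE DECL from each admissible export — by-`--workitem` closers (seat hubbard-kl-k3c5-p3 g7, VL co-registrant); the one-token (`klPredsV17F ↦ klPredsV17F2`)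
# re-key of …VolumeLimitV17FClosers (p527246, item 20371 superseded at rev 22)

Route `KLProgramme`, crux K3 `KLRegimeTwoPointLimit` (stmt-…-19937), gen-8 child `…Theses.KLProgramme.KLRegimeVolumeLimitV17F2 :=
VolumeLimitP2 klPredsV17F2 FinalTwoLegVolLimitEx klWindowC` (route rev 22).  Whatever the registered stub text, the item CLOSES (`--workitem stmt-…-20440`) from
ANY ONE of the following engine-flow exports at `(klPredsV17F2, klWindowC)`, through the (Pr W)-generic doors of this lineage (`hPr := klPredsV17F2_frameOK_frameOK`,
the (T-a) conjunct of the dummy frame class):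

* `KLRegimeVolumeLimitV17F2_of_nestedText` — (N) bare nested («cauchy v7»'s text); `…_of_perLabelThresholdsText` — per label;
* `…_of_perSiteLimitText` / `…_of_perSiteCutoffLimitText` / `…_of_perSiteTermwiseText` — per site `z ∈ ℤ²` and label `n`: ONE complex sequence converges
  (cutoff-free / finite-cutoff iterated / termwise-Tannery);
* `…_of_gibbsLimitText` — Hamiltonian words: the torus-Gibbs density and the Matsubara coefficients of one two-time pair function at fixed offsets converge;
* **`…_of_framedNestedFlowText`** — the FRAMED nested export in the flow's OWN frames `klFlowFrameU L M β U μ (nScales β + 1)` («cauchy v8-F2»): frame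
  comparability/bounds come from the rev-2 tower (`flowFrames_twoVolume_of_towerV17F2`), framed → bare by the exact last-scale dressing (p525120).

Everything is proved; no definition; nothing is asserted about the model.
-/

noncomputable section

namespace Summit.HubbardSuperconductivity.HubbardSuperconductivity.Theorems.TwoPointAssembly

set_option linter.dupNamespace false -- summit = problem name (single-conjunct summit), D-0017

open scoped ComplexConjugate
open Matrix Complex Finset Filter Topology Literature.MathematicalPhysics.QuantumLattice Literature.Probability.LatticeModels
open Literature.MathematicalPhysics.QuantumLattice.FermiRG
open Summit.HubbardSuperconductivity.HubbardSuperconductivity.Theorems.DispersionFlow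
open Summit.HubbardSuperconductivity.HubbardSuperconductivity.Theorems.KLRegimeSplit
open Summit.HubbardSuperconductivity.HubbardSuperconductivity.Theorems.KLProgrammeLegKernels

/-- **The gen-8 (rev-22) VL child from the BARE NESTED export (N) (= the registered stub `stub_vl_nested` of «cauchy v7»).** -/
theorem KLRegimeVolumeLimitV17F2_of_nestedText
    (h : ∀ (G : GeoConsts) (P : SplitConsts) (Q : EngConsts) (R : RenConsts), G.WF → P.WF → Q.WF → R.WF →
      ∃ c₅ : ℝ, 0 < c₅ ∧ ∀ c : ℝ, 0 < c → c ≤ c₅ → ∃ U₀ : ℝ, 0 < U₀ ∧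
        ∀ μ ∈ klWindowC, ∀ U : ℝ, 0 < U → U ≤ U₀ → ∀ β : ℝ, klBetaMin ≤ β → β ≤ Real.exp (c / U ^ 2) →
          ∀ K : TrigPolyC4v, klPredsV17F2.frameOK R U (nScales β) μ K →
            ∀ (Lstar : ℕ) (Mstar : ℕ → ℕ), TowerP klPredsV17F2 G P Q R β U μ K Lstar Mstar →
              ∃ L₀ : ℕ, ∃ ρ : ℕ → ℝ, Tendsto ρ atTop (𝓝 0) ∧
                ∀ (L : ℕ) [NeZero L], L₀ ≤ L → ∀ (L'' : ℕ) [NeZero L''], L ∣ L'' → ∃ M₀ : ℕ, ∀ (M : ℕ) [NeZero M], M₀ ≤ M →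
                  ∀ (ω : MatsubaraIdx M) (k : TorusSite 2 L) (k'' : TorusSite 2 L''), latticeMomentum L'' k'' = latticeMomentum L k →
                    ‖klSelfEnergy L M β U μ 0 klE0 (nScales β + 1) (ω, k) 0 -
                        klSelfEnergy L'' M β U μ 0 klE0 (nScales β + 1) (ω, k'') 0‖ ≤ ρ L) :
    Summit.HubbardSuperconductivity.HubbardSuperconductivity.Theses.KLProgramme.KLRegimeVolumeLimitV17F2 := by
  show VolumeLimitP2 klPredsV17F2 FinalTwoLegVolLimitEx klWindowC
  exact volumeLimitP2_of_nestedOnlyText klPredsV17F2 klWindowC klPredsV17F2_frameOK_frameOK h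

/-- **The gen-8 (rev-22) VL child from the bare nested export ONE MATSUBARA LABEL AT A TIME (label-dependent threshold and rate).** -/
theorem KLRegimeVolumeLimitV17F2_of_perLabelThresholdsText
    (h : ∀ (G : GeoConsts) (P : SplitConsts) (Q : EngConsts) (R : RenConsts), G.WF → P.WF → Q.WF → R.WF →
      ∃ c₅ : ℝ, 0 < c₅ ∧ ∀ c : ℝ, 0 < c → c ≤ c₅ → ∃ U₀ : ℝ, 0 < U₀ ∧
        ∀ μ ∈ klWindowC, ∀ U : ℝ, 0 < U → U ≤ U₀ → ∀ β : ℝ, klBetaMin ≤ β → β ≤ Real.exp (c / U ^ 2) →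
          ∀ K : TrigPolyC4v, klPredsV17F2.frameOK R U (nScales β) μ K →
            ∀ (Lstar : ℕ) (Mstar : ℕ → ℕ), TowerP klPredsV17F2 G P Q R β U μ K Lstar Mstar →
              ∀ n : ℤ, ∃ L₀ : ℕ, ∃ ρ : ℕ → ℝ, Tendsto ρ atTop (𝓝 0) ∧
                ∀ (L : ℕ) [NeZero L], L₀ ≤ L → ∀ (L'' : ℕ) [NeZero L''], L ∣ L'' → ∃ M₀ : ℕ, ∀ (M : ℕ) [NeZero M], M₀ ≤ M →
                  ∀ (ω : MatsubaraIdx M), matsubaraInt M ω = n → ∀ (k : TorusSite 2 L) (k'' : TorusSite 2 L''),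
                    latticeMomentum L'' k'' = latticeMomentum L k →
                      ‖klSelfEnergy L M β U μ 0 klE0 (nScales β + 1) (ω, k) 0 -
                          klSelfEnergy L'' M β U μ 0 klE0 (nScales β + 1) (ω, k'') 0‖ ≤ ρ L) :
    Summit.HubbardSuperconductivity.HubbardSuperconductivity.Theses.KLProgramme.KLRegimeVolumeLimitV17F2 := by
  show VolumeLimitP2 klPredsV17F2 FinalTwoLegVolLimitEx klWindowC
  exact volumeLimitP2_of_perLabelThresholdsOnlyText klPredsV17F2 klWindowC klPredsV17F2_frameOK_frameOK h

/-- **The gen-8 (rev-22) VL child from PER-SITE PLAIN LIMITS of the cutoff-free carrier's site kernel (BGM 2006 Lemma 2.4 verbatim).** -/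
theorem KLRegimeVolumeLimitV17F2_of_perSiteLimitText
    (h : ∀ (G : GeoConsts) (P : SplitConsts) (Q : EngConsts) (R : RenConsts), G.WF → P.WF → Q.WF → R.WF →
      ∃ c₅ : ℝ, 0 < c₅ ∧ ∀ c : ℝ, 0 < c → c ≤ c₅ → ∃ U₀ : ℝ, 0 < U₀ ∧
        ∀ μ ∈ klWindowC, ∀ U : ℝ, 0 < U → U ≤ U₀ → ∀ β : ℝ, klBetaMin ≤ β → β ≤ Real.exp (c / U ^ 2) →
          ∀ K : TrigPolyC4v, klPredsV17F2.frameOK R U (nScales β) μ K →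
            ∀ (Lstar : ℕ) (Mstar : ℕ → ℕ), TowerP klPredsV17F2 G P Q R β U μ K Lstar Mstar →
              ∀ (n : ℤ) (z : Site 2), ∃ hlim : ℂ, ∀ ε > (0 : ℝ), ∃ L₁ : ℕ, ∀ (L : ℕ) [NeZero L], L₁ ≤ L →
                ‖torusFourierInv (fun p : TorusSite 2 L => klSelfEnergyInf L β U μ 0 n p) (Torus.proj L z) - hlim‖ ≤ ε) :
    Summit.HubbardSuperconductivity.HubbardSuperconductivity.Theses.KLProgramme.KLRegimeVolumeLimitV17F2 := by
  show VolumeLimitP2 klPredsV17F2 FinalTwoLegVolLimitEx klWindowC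
  exact volumeLimitP2_of_perSiteLimitText klPredsV17F2 klWindowC klPredsV17F2_frameOK_frameOK h

/-- **The gen-8 (rev-22) VL child from PER-SITE ITERATED FINITE-CUTOFF LIMITS `lim_L lim_M` of the site kernel of the finite-cutoff bare carrier.** -/
theorem KLRegimeVolumeLimitV17F2_of_perSiteCutoffLimitText
    (h : ∀ (G : GeoConsts) (P : SplitConsts) (Q : EngConsts) (R : RenConsts), G.WF → P.WF → Q.WF → R.WF →
      ∃ c₅ : ℝ, 0 < c₅ ∧ ∀ c : ℝ, 0 < c → c ≤ c₅ → ∃ U₀ : ℝ, 0 < U₀ ∧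
        ∀ μ ∈ klWindowC, ∀ U : ℝ, 0 < U → U ≤ U₀ → ∀ β : ℝ, klBetaMin ≤ β → β ≤ Real.exp (c / U ^ 2) →
          ∀ K : TrigPolyC4v, klPredsV17F2.frameOK R U (nScales β) μ K →
            ∀ (Lstar : ℕ) (Mstar : ℕ → ℕ), TowerP klPredsV17F2 G P Q R β U μ K Lstar Mstar →
              ∀ (n : ℤ) (z : Site 2), ∃ hlim : ℂ, ∀ ε > (0 : ℝ), ∃ L₁ : ℕ, ∀ (L : ℕ) [NeZero L], L₁ ≤ L →
                ∃ M₁ : ℕ, ∀ (M : ℕ) [NeZero M], M₁ ≤ M → ∀ ω : MatsubaraIdx M, matsubaraInt M ω = n →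
                  ‖torusFourierInv (fun p : TorusSite 2 L => klSelfEnergy L M β U μ 0 klE0 (nScales β + 1) (ω, p) 0) (Torus.proj L z) - hlim‖ ≤ ε) :
    Summit.HubbardSuperconductivity.HubbardSuperconductivity.Theses.KLProgramme.KLRegimeVolumeLimitV17F2 := by
  show VolumeLimitP2 klPredsV17F2 FinalTwoLegVolLimitEx klWindowC
  exact volumeLimitP2_of_perSiteCutoffLimitText klPredsV17F2 klWindowC klPredsV17F2_frameOK_frameOK h

/-- **The gen-8 (rev-22) VL child from PER-SITE TERMWISE expansions with an `L`-uniform summable majorant (Tannery; Lemma 2.4's proof shape).** -/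
theorem KLRegimeVolumeLimitV17F2_of_perSiteTermwiseText
    (h : ∀ (G : GeoConsts) (P : SplitConsts) (Q : EngConsts) (R : RenConsts), G.WF → P.WF → Q.WF → R.WF →
      ∃ c₅ : ℝ, 0 < c₅ ∧ ∀ c : ℝ, 0 < c → c ≤ c₅ → ∃ U₀ : ℝ, 0 < U₀ ∧
        ∀ μ ∈ klWindowC, ∀ U : ℝ, 0 < U → U ≤ U₀ → ∀ β : ℝ, klBetaMin ≤ β → β ≤ Real.exp (c / U ^ 2) →
          ∀ K : TrigPolyC4v, klPredsV17F2.frameOK R U (nScales β) μ K →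
            ∀ (Lstar : ℕ) (Mstar : ℕ → ℕ), TowerP klPredsV17F2 G P Q R β U μ K Lstar Mstar →
              ∀ (n : ℤ) (z : Site 2), ∃ (ι : Type) (a : ι → ℕ → ℂ) (alim : ι → ℂ) (m : ι → ℝ) (L₀ : ℕ),
                Summable m ∧ (∀ i, Tendsto (a i) atTop (𝓝 (alim i))) ∧ (∀ i L, L₀ ≤ L → ‖a i L‖ ≤ m i) ∧
                  ∀ (L : ℕ) [NeZero L], L₀ ≤ L →
                    torusFourierInv (fun p : TorusSite 2 L => klSelfEnergyInf L β U μ 0 n p) (Torus.proj L z) = ∑' i, a i L) :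
    Summit.HubbardSuperconductivity.HubbardSuperconductivity.Theses.KLProgramme.KLRegimeVolumeLimitV17F2 := by
  show VolumeLimitP2 klPredsV17F2 FinalTwoLegVolLimitEx klWindowC
  exact volumeLimitP2_of_perSiteTermwiseText klPredsV17F2 klWindowC klPredsV17F2_frameOK_frameOK h

/-- **The gen-8 (rev-22) VL child from the thermodynamic limit of the torus GIBBS STATE at the density and one two-time pair function (Hamiltonian words).** -/
theorem KLRegimeVolumeLimitV17F2_of_gibbsLimitText
    (h : ∀ (G : GeoConsts) (P : SplitConsts) (Q : EngConsts) (R : RenConsts), G.WF → P.WF → Q.WF → R.WF →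
      ∃ c₅ : ℝ, 0 < c₅ ∧ ∀ c : ℝ, 0 < c → c ≤ c₅ → ∃ U₀ : ℝ, 0 < U₀ ∧
        ∀ μ ∈ klWindowC, ∀ U : ℝ, 0 < U → U ≤ U₀ → ∀ β : ℝ, klBetaMin ≤ β → β ≤ Real.exp (c / U ^ 2) →
          ∀ K : TrigPolyC4v, klPredsV17F2.frameOK R U (nScales β) μ K →
            ∀ (Lstar : ℕ) (Mstar : ℕ → ℕ), TowerP klPredsV17F2 G P Q R β U μ K Lstar Mstar →
              (∃ d : ℂ, ∀ ε > (0 : ℝ), ∃ L₁ : ℕ, ∀ (L : ℕ) [NeZero L], L₁ ≤ L →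
                  ‖hubbardThermalTwoPoint β U (μ + U / 2) L 0 0 1 1 - d‖ ≤ ε) ∧
              ∀ (n : ℤ) (z : Site 2), ∃ hg : ℂ, ∀ ε > (0 : ℝ), ∃ L₁ : ℕ, ∀ (L : ℕ) [NeZero L], L₁ ≤ L →
                ‖(∫ τ in (0 : ℝ)..β, cexp (I * ((Real.pi * (2 * (n : ℝ) + 1) / β : ℝ) : ℂ) * τ) *
                    gibbsState β (hubbardTorusWith 2 L 1 U (μ + U / 2))
                      (imagTimeEvolve (hubbardTorusWith 2 L 1 U (μ + U / 2)) (τ : ℂ)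
                        (annihilation (orb (FermionTorus.ofTorusSite (0 : TorusSite 2 L)) 0) *
                            numberOp (FermionTorus.ofTorusSite (0 : TorusSite 2 L)) 1 -
                          (1 / 2 : ℂ) • annihilation (orb (FermionTorus.ofTorusSite (0 : TorusSite 2 L)) 0)) *
                        (annihilation (orb (FermionTorus.ofTorusSite (Torus.proj L z)) 0) *
                            numberOp (FermionTorus.ofTorusSite (Torus.proj L z)) 1 -
                          (1 / 2 : ℂ) • annihilation (orb (FermionTorus.ofTorusSite (Torus.proj L z)) 0))ᴴ)) - hg‖ ≤ ε) :
    Summit.HubbardSuperconductivity.HubbardSuperconductivity.Theses.KLProgramme.KLRegimeVolumeLimitV17F2 := by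
  show VolumeLimitP2 klPredsV17F2 FinalTwoLegVolLimitEx klWindowC
  exact volumeLimitP2_of_gibbsLimitText klPredsV17F2 klWindowC klPredsV17F2_frameOK_frameOK h

/-- **The gen-8 (rev-22) VL child from the FRAMED nested export IN THE FLOW'S OWN FRAMES («cauchy v8-F»'s stub; frame comparability and bounds are theorems of the tower, …FlowFrames).** -/
theorem KLRegimeVolumeLimitV17F2_of_framedNestedFlowText
    (h : ∀ (G : GeoConsts) (P : SplitConsts) (Q : EngConsts) (R : RenConsts), G.WF → P.WF → Q.WF → R.WF →
      ∃ c₅ : ℝ, 0 < c₅ ∧ ∀ c : ℝ, 0 < c → c ≤ c₅ → ∃ U₀ : ℝ, 0 < U₀ ∧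
        ∀ μ ∈ klWindowC, ∀ U : ℝ, 0 < U → U ≤ U₀ → ∀ β : ℝ, klBetaMin ≤ β → β ≤ Real.exp (c / U ^ 2) →
          ∀ K : TrigPolyC4v, klPredsV17F2.frameOK R U (nScales β) μ K →
            ∀ (Lstar : ℕ) (Mstar : ℕ → ℕ), TowerP klPredsV17F2 G P Q R β U μ K Lstar Mstar →
              ∀ n : ℤ, ∃ L₀ : ℕ, ∃ ρ : ℕ → ℝ, Tendsto ρ atTop (𝓝 0) ∧
                ∀ (L : ℕ) [NeZero L], L₀ ≤ L → ∀ (L'' : ℕ) [NeZero L''], L ∣ L'' → ∃ M₀ : ℕ, ∀ (M : ℕ) [NeZero M], M₀ ≤ M →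
                  ∀ (ω : MatsubaraIdx M), matsubaraInt M ω = n → ∀ (k : TorusSite 2 L) (k'' : TorusSite 2 L''),
                    latticeMomentum L'' k'' = latticeMomentum L k →
                      ‖klSelfEnergy L M β U μ (klFlowFrameU L M β U μ (nScales β + 1)) klE0 (nScales β + 1) (ω, k) 0 -
                          klSelfEnergy L'' M β U μ (klFlowFrameU L'' M β U μ (nScales β + 1)) klE0 (nScales β + 1) (ω, k'') 0‖ ≤ ρ L) :
    Summit.HubbardSuperconductivity.HubbardSuperconductivity.Theses.KLProgramme.KLRegimeVolumeLimitV17F2 := by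
  show VolumeLimitP2 klPredsV17F2 FinalTwoLegVolLimitEx klWindowC
  exact volumeLimitTextV17F2_of_framedNestedFlowText h

end Summit.HubbardSuperconductivity.HubbardSuperconductivity.Theorems.TwoPointAssembly

end
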